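import Mathlib
import Summits.ValiantsHypothesis.ValiantsHypothesis.Theorems.BarrierLeverPartitionMinorsHitByVPHiddenStatesTiltCore
import Summits.ValiantsHypothesis.ValiantsHypothesis.Theorems.BarrierLeverPartitionMinorsHitByVPHiddenStatesFlagCore
import Summits.ValiantsHypothesis.ValiantsHypothesis.Theorems.BarrierLeverPartitionMinorsHitByVPHiddenStatesFreeCompletion
import Summits.ValiantsHypothesis.ValiantsHypothesis.Theorems.BarrierLeverPartitionMinorsHitByVPHiddenStatesCoreLiftCells
import Summits.ValiantsHypothesis.ValiantsHypothesis.Theorems.BarrierLeverPartitionMinorsHitByVPHiddenStatesCoordEmbed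

/-!
# Route BarrierLever — item `PartitionMinorsHitByVP` (stmt-ValiantsHypothesis-19717), line `hidden-states`:
# TILTED CUBES IV — the flag design `𝔉(h,2)` serves the core-ONE family; the lower node at co-size `c = h` and the `c ≤ 20` column

Helper file (`--supports stmt-ValiantsHypothesis-19717`; cell valiant-natproofs, rung V4, 𝒟-side door (c), registered line
`Cruxes/PartitionMinorsHitByVP/Lines/hidden_states.lean` v7; prover seat val-np-p6 gen 12). Definition-free; closes NO item.

* `symGood_flagTwo_canonical`, **`symGood_flagTwo_coreOne`** — THE TILT THEOREM: any design with the range description of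
  `FlagCells.flag_design` at `t = 2` (two nested full cubes ⊔ stars) is generically good for EVERY injective row family in `Fin (d+2)`
  containing all sets of size `≤ d` and one co-singleton `univ ∖ x₀` — in particular for the down-set `B_{h−2}([h]) ∪ {univ ∖ x₀}`
  (core exactly one), which NO cut tree certifies (memo val-np-p6 g11 §5: every affinely-closed cut misses it; the 0/1 flag needs
  core `≥ 2`). Mechanism: `Tilt.exists_indepTable` (tilt table, quadratic defect `2λ = 0`) + free completion (p626424) + a coordinate
  swap (`SymbJoin.symGood_map_embedding`, p592006).
* **`universalJoinWideLower_coDim`** — the LOWER NODE AT CO-SIZE `c = h` for every `4 ≤ h ≤ 20` (`2^{h−2} − h` star points fit the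
  budget): a down-set of co-size `h` has core `≥ 1`; core `≥ 2` is the flag tiling (`FlagCells.flag_serves_of_core`), core `= 1` forces
  `U = B_{h−2} ∪ {univ ∖ x₀}` and is the tilt theorem — ONE design for all of them.
* `universalJoinWideLower_coTop_twenty` — with the core lift (p625816/p626621): the lower node at `(h, 2^h − c)` for every `h ≥ 20` and
  every `c ≤ 20`; `universalJoinWideLower_top_twenty`: every `h ≥ 4`, every `c ≤ min(h, 20)`.

WHAT THIS IS NOT: the `c = 20` column (from `h = 20` on) is one more size per `h`; the star budget caps the direct tilt cell at `h ≤ 20`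
and the lift carries only `c ≤ 20` upward; nothing in the bulk; no stub of the line is closed; nothing on crux 14610 or VP ≠ VNP.
-/

set_option linter.dupNamespace false

namespace Summit.ValiantsHypothesis.ValiantsHypothesis.Theorems.BarrierLever.HiddenStates

open Finset Matrix MvPolynomial

noncomputable section

namespace Tilt

/-- **The tilt theorem, canonical position** (`x₀ = Fin.last (d+1)`). -/
theorem symGood_flagTwo_canonical (d r : ℕ) (hd : 2 ≤ d) (n : Fin ((d + 2) + (d + 2)) → ℕ)
    (e : Fin r → Fin ((d + 2) + (d + 2)) × Finset (Fin ((d + 2) * (d + 2) * (d + 2)))) (he : Function.Injective e)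
    (hmem : ∀ x : Fin ((d + 2) + (d + 2)) × Finset (Fin ((d + 2) * (d + 2) * (d + 2))), x ∈ Set.range e ↔
        ((x.1 : ℕ) < 2 ∧ ∀ q ∈ x.2, (q : ℕ) < (d + 2) - 1 - x.1) ∨
          (2 ≤ (x.1 : ℕ) ∧ ((x.2 = ∅ ∧ 1 ≤ n x.1) ∨ ∃ q, x.2 = {q} ∧ (q : ℕ) + 1 < n x.1)))
    (u : Fin r → Finset (Fin (d + 2))) (hu : Function.Injective u)
    (hrows : ∀ S : Finset (Fin (d + 2)), S.card ≤ d → S ∈ Set.range u)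
    (hrow' : Finset.univ.erase (Fin.last (d + 1)) ∈ Set.range u) :
    SymbJoin.symDet u e ≠ 0 := by
  classical
  have hK : d + 1 ≤ (d + 2) * (d + 2) * (d + 2) := by nlinarith
  let p₀ : Fin ((d + 2) + (d + 2)) := ⟨0, by omega⟩
  let p₁ : Fin ((d + 2) + (d + 2)) := ⟨1, by omega⟩
  have hp : p₀ ≠ p₁ := fun h' => by have := congrArg Fin.val h'; simp [p₀, p₁] at this
  have hP0 : ∀ k, (e k).1 = p₀ → ∀ q ∈ (e k).2, (q : ℕ) < d + 1 := by
    intro k hk q hq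
    rcases (hmem (e k)).mp ⟨k, rfl⟩ with ⟨-, hJ⟩ | ⟨hge, -⟩
    · have := hJ q hq; rw [hk] at this; simp [p₀] at this; omega
    · rw [hk] at hge; simp [p₀] at hge
  have hP1 : ∀ k, (e k).1 = p₁ → ∀ q ∈ (e k).2, (q : ℕ) < d := by
    intro k hk q hq
    rcases (hmem (e k)).mp ⟨k, rfl⟩ with ⟨-, hJ⟩ | ⟨hge, -⟩
    · have := hJ q hq; rw [hk] at this; simp [p₁] at this; omega
    · rw [hk] at hge; simp [p₁] at hge
  obtain ⟨tx₀, hind⟩ := exists_indepTable d r _ _ hd hK e he p₀ p₁ hp hP0 hP1 u hrows hrow'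
  refine SymbJoin.symGood_of_indepCore u hu e he {p₀, p₁} ?_ tx₀ ?_
  · intro k hk
    rw [Finset.mem_insert, Finset.mem_singleton, not_or] at hk
    have hge : ¬ ((e k).1 : ℕ) < 2 := by
      intro hlt
      rcases Nat.lt_succ_iff_lt_or_eq.mp hlt with h0 | h1
      · exact hk.1 (Fin.ext (show ((e k).1 : ℕ) = 0 by omega))
      · exact hk.2 (Fin.ext (show ((e k).1 : ℕ) = 1 by omega))
    rcases (hmem (e k)).mp ⟨k, rfl⟩ with ⟨hlt, -⟩ | ⟨-, ⟨h0, -⟩ | ⟨q, hq, -⟩⟩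
    · exact absurd hlt hge
    · rw [h0]; simp
    · rw [hq]; simp
  · intro α hα hsum
    exact hind α (fun k h0 h1 => hα k (by rw [Finset.mem_insert, Finset.mem_singleton, not_or]; exact ⟨h0, h1⟩)) hsum

/-- **THE TILT THEOREM.** As `symGood_flagTwo_canonical`, for an arbitrary core coordinate `x₀`. -/
theorem symGood_flagTwo_coreOne (d r : ℕ) (hd : 2 ≤ d) (n : Fin ((d + 2) + (d + 2)) → ℕ)
    (e : Fin r → Fin ((d + 2) + (d + 2)) × Finset (Fin ((d + 2) * (d + 2) * (d + 2)))) (he : Function.Injective e)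
    (hmem : ∀ x : Fin ((d + 2) + (d + 2)) × Finset (Fin ((d + 2) * (d + 2) * (d + 2))), x ∈ Set.range e ↔
        ((x.1 : ℕ) < 2 ∧ ∀ q ∈ x.2, (q : ℕ) < (d + 2) - 1 - x.1) ∨
          (2 ≤ (x.1 : ℕ) ∧ ((x.2 = ∅ ∧ 1 ≤ n x.1) ∨ ∃ q, x.2 = {q} ∧ (q : ℕ) + 1 < n x.1)))
    (u : Fin r → Finset (Fin (d + 2))) (hu : Function.Injective u) (x₀ : Fin (d + 2))
    (hrows : ∀ S : Finset (Fin (d + 2)), S.card ≤ d → S ∈ Set.range u)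
    (hrow' : Finset.univ.erase x₀ ∈ Set.range u) :
    SymbJoin.symDet u e ≠ 0 := by
  classical
  let π : Fin (d + 2) ≃ Fin (d + 2) := Equiv.swap x₀ (Fin.last (d + 1))
  have hππ : ∀ a, π (π a) = a := fun a => Equiv.swap_apply_self _ _ _
  let u' : Fin r → Finset (Fin (d + 2)) := fun i => (u i).map π.toEmbedding
  have hmapmap : ∀ S : Finset (Fin (d + 2)), (S.map π.toEmbedding).map π.toEmbedding = S := by
    intro S; ext a
    simp only [Finset.mem_map, Equiv.coe_toEmbedding]
    constructor
    · rintro ⟨b, ⟨c, hc, rfl⟩, rfl⟩; rw [hππ]; exact hc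
    · intro ha; exact ⟨π a, ⟨a, ha, rfl⟩, hππ a⟩
  have hu' : Function.Injective u' := fun i j hij => hu (by simpa [u'] using congrArg (fun S => S.map π.toEmbedding) hij |>.trans (hmapmap _) |> fun h => (hmapmap _).symm.trans h)
  have hrows' : ∀ S : Finset (Fin (d + 2)), S.card ≤ d → S ∈ Set.range u' := by
    intro S hS
    obtain ⟨i, hi⟩ := hrows (S.map π.toEmbedding) (by rw [Finset.card_map]; exact hS)
    exact ⟨i, by simp only [u', hi, hmapmap]⟩
  have hrow'' : Finset.univ.erase (Fin.last (d + 1)) ∈ Set.range u' := by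
    obtain ⟨i, hi⟩ := hrow'
    refine ⟨i, ?_⟩
    simp only [u', hi]
    ext a
    simp only [Finset.mem_map, Finset.mem_erase, Finset.mem_univ, and_true, Equiv.coe_toEmbedding]
    constructor
    · rintro ⟨b, hb, rfl⟩
      intro h'
      apply hb
      have : π (π b) = π (Fin.last (d + 1)) := by rw [h']
      rw [hππ] at this
      rw [this]; simp [π, Equiv.swap_apply_right]
    · intro ha
      refine ⟨π a, ?_, hππ a⟩
      intro h'
      apply ha
      have : π (π a) = π x₀ := by rw [h']
      rw [hππ] at this
      rw [this]; simp [π, Equiv.swap_apply_left]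
  have hG := symGood_flagTwo_canonical d r hd n e he hmem u' hu' hrows' hrow''
  have := SymbJoin.symGood_map_embedding π.toEmbedding u' e hG
  have hback : (fun i => (u' i).map π.toEmbedding) = u := funext fun i => hmapmap (u i)
  rwa [hback] at this

end Tilt

namespace TiltCells

/-- **THE LOWER NODE AT CO-SIZE `c = h`, `4 ≤ h ≤ 20`** (more precisely whenever the `2^{h−2} − h` star points fit the budget):
the body of `LowerNode.Stmt.universalJoinWideLower` at `(h, 2^h − h)`. -/
theorem universalJoinWideLower_coDim (h : ℕ) (h4 : 4 ≤ h) (hcap : 2 ^ (h - 2) ≤ (h + h - 2) * (h * h * h + 1) + h) :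
    ∃ (m K : ℕ) (W : Fin m → ℕ) (wt : Fin m → Fin K → ℕ) (e : Fin (2 ^ h - h) → Fin m × Finset (Fin K)),
      m ≤ h + h ∧ K ≤ h * h * h ∧ Function.Injective e ∧
      (∀ x : Fin m × Finset (Fin K), x ∉ Set.range e →
        ∀ i, W (e i).1 + ∑ k ∈ (e i).2, wt (e i).1 k < W x.1 + ∑ k ∈ x.2, wt x.1 k) ∧
      ∀ u : Fin (2 ^ h - h) → Finset (Fin h), Function.Injective u → IsLowerSet (Set.range u) →
        ∃ tx : Fin m → Option (Fin K) → Fin h → ℂ,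
          (Matrix.of fun i k : Fin (2 ^ h - h) =>
            ∏ a ∈ u i, (tx (e k).1 none a + ∑ q ∈ (e k).2, tx (e k).1 (some q) a)).det ≠ 0 := by
  classical
  obtain ⟨d, rfl⟩ : ∃ d, h = d + 2 := ⟨h - 2, by omega⟩
  have hd : 2 ≤ d := by omega
  have hsub : d + 2 - 2 = d := by omega
  rw [hsub] at hcap
  have hpow : 2 ^ (d + 2) = 4 * 2 ^ d := by rw [pow_succ, pow_succ]; ring
  have hdle' : ∀ n : ℕ, 2 ≤ n → n + 2 ≤ 2 ^ n := by
    intro n hn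
    induction n, hn using Nat.le_induction with
    | base => norm_num
    | succ n hn ih => rw [pow_succ]; omega
  have hdle : d + 2 ≤ 2 ^ d := hdle' d hd
  -- the design 𝔉(d+2, 2, n)
  set N := 2 ^ d - (d + 2) with hN
  obtain ⟨n, hn0, hnL, hsum⟩ := FlagCells.exists_distribution 2 ((d + 2) * (d + 2) * (d + 2) + 1) ((d + 2) + (d + 2)) N
    (by rw [hN]; have : (d + 2 + (d + 2) - 2) = d + 2 + (d + 2) - 2 := rfl; omega)
  have hr : 2 ^ (d + 2) - (d + 2) = (2 ^ (d + 2) - 2 ^ (d + 2 - 2)) + ∑ p, n p := by rw [hsum, hN, hsub, hpow]; omega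
  obtain ⟨e, he, hthr, hmem⟩ := FlagCells.flag_design (d + 2) 2 (by omega) n hn0 hnL (2 ^ (d + 2) - (d + 2)) hr
  refine ⟨(d + 2) + (d + 2), (d + 2) * (d + 2) * (d + 2), fun p => if ((p : ℕ) < 2 ∨ 1 ≤ n p) then 0 else 2,
    fun p q => if (p : ℕ) < 2 then (if (q : ℕ) < (d + 2) - 1 - p then 0 else 2) else (if (q : ℕ) + 1 < n p then 1 else 2),
    e, le_rfl, le_rfl, he, hthr, ?_⟩
  intro u hu hlow
  -- the missing up-set and its core
  set 𝒜 : Finset (Finset (Fin (d + 2))) := Finset.univ \ Finset.univ.image u with h𝒜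
  have h𝒜c : 𝒜.card = d + 2 := by
    rw [h𝒜, Finset.card_sdiff_of_subset (Finset.subset_univ _), Finset.card_univ, Fintype.card_finset, Fintype.card_fin,
      Finset.card_image_of_injective _ hu, Finset.card_univ, Fintype.card_fin]
    omega
  have hrowiff : ∀ S, S ∈ Set.range u ↔ S ∉ 𝒜 := by
    intro S
    rw [h𝒜, Finset.mem_sdiff, not_and, not_not, Finset.mem_image]
    constructor
    · rintro ⟨i, rfl⟩ _; exact ⟨i, Finset.mem_univ _, rfl⟩
    · intro hS; obtain ⟨i, -, hi⟩ := hS (Finset.mem_univ _); exact ⟨i, hi⟩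
  have hup : ∀ A ∈ 𝒜, ∀ A', A ⊆ A' → A' ∈ 𝒜 := by
    intro A hA A' hAA'
    rw [h𝒜, Finset.mem_sdiff] at hA ⊢
    refine ⟨Finset.mem_univ _, fun hA' => hA.2 ?_⟩
    obtain ⟨i, -, rfl⟩ := Finset.mem_image.mp hA'
    obtain ⟨j, hj⟩ := hlow hAA' ⟨i, rfl⟩
    exact Finset.mem_image.mpr ⟨j, Finset.mem_univ _, hj⟩
  have hne : 𝒜.Nonempty := by rw [← Finset.card_pos, h𝒜c]; omega
  have huniv : (Finset.univ : Finset (Fin (d + 2))) ∈ 𝒜 := by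
    obtain ⟨A, hA⟩ := hne; exact hup A hA _ (Finset.subset_univ A)
  set C₀ : Finset (Fin (d + 2)) := Finset.univ.filter fun x => ∀ A ∈ 𝒜, x ∈ A with hC₀
  have hB := FlagCells.card_noncore_succ_le 𝒜 hup hne
  have hcomp : (Finset.univ.filter fun x : Fin (d + 2) => ∃ A ∈ 𝒜, x ∉ A) = Finset.univ \ C₀ := by
    rw [hC₀]; ext x; simp
  rw [hcomp, Finset.card_sdiff_of_subset (Finset.subset_univ _), Finset.card_univ, Fintype.card_fin, h𝒜c] at hB
  have hC₀le : C₀.card ≤ d + 2 := by have := Finset.card_le_univ C₀; rwa [Fintype.card_fin] at this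
  by_cases hcore2 : 2 ≤ C₀.card
  · -- core ≥ 2: the flag tiling
    exact FlagCells.flag_serves_of_core (d + 2) 2 _ (by omega) n e he hmem u hu hlow hcore2
  · -- core = 1: the family is `B_d ∪ {univ ∖ x₀}`, the tilt theorem
    have hC₀1 : C₀.card = 1 := by omega
    obtain ⟨x₀, hx₀⟩ := Finset.card_eq_one.mp hC₀1
    have hx₀C : x₀ ∈ C₀ := by rw [hx₀]; exact Finset.mem_singleton_self x₀
    have hx₀core : ∀ A ∈ 𝒜, x₀ ∈ A := (Finset.mem_filter.mp hx₀C).2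
    have hnoncore : ∀ y, y ≠ x₀ → Finset.univ.erase y ∈ 𝒜 := by
      intro y hy
      have hyC : y ∉ C₀ := by rw [hx₀, Finset.mem_singleton]; exact hy
      have : ¬ ∀ A ∈ 𝒜, y ∈ A := fun h' => hyC (Finset.mem_filter.mpr ⟨Finset.mem_univ _, h'⟩)
      push Not at this
      obtain ⟨A, hA, hyA⟩ := this
      exact hup A hA _ fun z hz => Finset.mem_erase.mpr ⟨fun hzy => hyA (hzy ▸ hz), Finset.mem_univ z⟩
    refine SymbJoin.exists_table_of_symGood u e (Tilt.symGood_flagTwo_coreOne d _ hd n e he hmem u hu x₀ ?_ ?_)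
    · -- every set of size ≤ d is a row
      intro S hS
      rw [hrowiff]
      intro hS𝒜
      -- 𝒜 would contain univ, the d+1 co-singletons at y ≠ x₀, and S: too many
      have hsub : insert S (insert Finset.univ ((Finset.univ.erase x₀).image fun y => Finset.univ.erase y)) ⊆ 𝒜 := by
        intro A hA
        rcases Finset.mem_insert.mp hA with rfl | hA
        · exact hS𝒜
        rcases Finset.mem_insert.mp hA with rfl | hA
        · exact huniv
        obtain ⟨y, hy, rfl⟩ := Finset.mem_image.mp hA
        exact hnoncore y (Finset.ne_of_mem_erase hy)
      have hcard := Finset.card_le_card hsub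
      have hinj : Set.InjOn (fun y : Fin (d + 2) => Finset.univ.erase y) ↑(Finset.univ.erase x₀) :=
        fun y _ y' _ hyy => Finset.erase_injOn _ (Finset.mem_univ y) (Finset.mem_univ y') hyy
      have hS1 : S ∉ insert Finset.univ ((Finset.univ.erase x₀).image fun y => Finset.univ.erase y) := by
        intro h'
        rcases Finset.mem_insert.mp h' with rfl | h'
        · rw [Finset.card_univ, Fintype.card_fin] at hS; omega
        · obtain ⟨y, -, rfl⟩ := Finset.mem_image.mp h'
          rw [Finset.card_erase_of_mem (Finset.mem_univ y), Finset.card_univ, Fintype.card_fin] at hS; omega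
      have hS2 : (Finset.univ : Finset (Fin (d + 2))) ∉ (Finset.univ.erase x₀).image fun y => Finset.univ.erase y := by
        intro h'
        obtain ⟨y, -, hy⟩ := Finset.mem_image.mp h'
        have : y ∉ Finset.univ.erase y := Finset.notMem_erase y _
        rw [hy] at this; exact this (Finset.mem_univ y)
      rw [Finset.card_insert_of_notMem hS1, Finset.card_insert_of_notMem hS2, Finset.card_image_of_injOn hinj,
        Finset.card_erase_of_mem (Finset.mem_univ x₀), Finset.card_univ, Fintype.card_fin, h𝒜c] at hcard
      omega
    · rw [hrowiff]
      intro h'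
      exact Finset.notMem_erase x₀ _ (hx₀core _ h')

/-- `4 ≤ h ≤ 20`: the star budget holds, so the lower node holds at `(h, 2^h − h)`. -/
theorem universalJoinWideLower_coDim_le_twenty (h : ℕ) (h4 : 4 ≤ h) (h20 : h ≤ 20) :
    ∃ (m K : ℕ) (W : Fin m → ℕ) (wt : Fin m → Fin K → ℕ) (e : Fin (2 ^ h - h) → Fin m × Finset (Fin K)),
      m ≤ h + h ∧ K ≤ h * h * h ∧ Function.Injective e ∧
      (∀ x : Fin m × Finset (Fin K), x ∉ Set.range e →
        ∀ i, W (e i).1 + ∑ k ∈ (e i).2, wt (e i).1 k < W x.1 + ∑ k ∈ x.2, wt x.1 k) ∧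
      ∀ u : Fin (2 ^ h - h) → Finset (Fin h), Function.Injective u → IsLowerSet (Set.range u) →
        ∃ tx : Fin m → Option (Fin K) → Fin h → ℂ,
          (Matrix.of fun i k : Fin (2 ^ h - h) =>
            ∏ a ∈ u i, (tx (e k).1 none a + ∑ q ∈ (e k).2, tx (e k).1 (some q) a)).det ≠ 0 := by
  refine universalJoinWideLower_coDim h h4 ?_
  interval_cases h <;> norm_num

/-- **The `c ≤ 20` column**: for every `h ≥ 20` and every `c ≤ 20`, the lower node at `(h, 2^h − c)`. -/
theorem universalJoinWideLower_coTop_twenty (h c : ℕ) (h20 : 20 ≤ h) (hc : c ≤ 20) :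
    ∃ (m K : ℕ) (W : Fin m → ℕ) (wt : Fin m → Fin K → ℕ) (e : Fin (2 ^ h - c) → Fin m × Finset (Fin K)),
      m ≤ h + h ∧ K ≤ h * h * h ∧ Function.Injective e ∧
      (∀ x : Fin m × Finset (Fin K), x ∉ Set.range e →
        ∀ i, W (e i).1 + ∑ k ∈ (e i).2, wt (e i).1 k < W x.1 + ∑ k ∈ x.2, wt x.1 k) ∧
      ∀ u : Fin (2 ^ h - c) → Finset (Fin h), Function.Injective u → IsLowerSet (Set.range u) →
        ∃ tx : Fin m → Option (Fin K) → Fin h → ℂ,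
          (Matrix.of fun i k : Fin (2 ^ h - c) =>
            ∏ a ∈ u i, (tx (e k).1 none a + ∑ q ∈ (e k).2, tx (e k).1 (some q) a)).det ≠ 0 := by
  by_cases hc19 : c ≤ 19
  · exact CoreLift.universalJoinWideLower_coTop_nineteen h c (by omega) hc19
  · obtain rfl : c = 20 := by omega
    obtain ⟨d, rfl⟩ : ∃ d, h = 20 + d := ⟨h - 20, by omega⟩
    exact CoreLift.universalJoinWideLower_lift_iter 20 20 (by norm_num) (by norm_num)
      (universalJoinWideLower_coDim_le_twenty 20 (by norm_num) le_rfl) d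

/-- **Summary: the lower node at `(h, 2^h − c)` for every `h ≥ 4` and every `c ≤ min(h, 20)`.** -/
theorem universalJoinWideLower_top_twenty (h c : ℕ) (h4 : 4 ≤ h) (hch : c ≤ h) (hc : c ≤ 20) :
    ∃ (m K : ℕ) (W : Fin m → ℕ) (wt : Fin m → Fin K → ℕ) (e : Fin (2 ^ h - c) → Fin m × Finset (Fin K)),
      m ≤ h + h ∧ K ≤ h * h * h ∧ Function.Injective e ∧
      (∀ x : Fin m × Finset (Fin K), x ∉ Set.range e →
        ∀ i, W (e i).1 + ∑ k ∈ (e i).2, wt (e i).1 k < W x.1 + ∑ k ∈ x.2, wt x.1 k) ∧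
      ∀ u : Fin (2 ^ h - c) → Finset (Fin h), Function.Injective u → IsLowerSet (Set.range u) →
        ∃ tx : Fin m → Option (Fin K) → Fin h → ℂ,
          (Matrix.of fun i k : Fin (2 ^ h - c) =>
            ∏ a ∈ u i, (tx (e k).1 none a + ∑ q ∈ (e k).2, tx (e k).1 (some q) a)).det ≠ 0 := by
  by_cases h18 : h ≤ 18
  · obtain ⟨m, K, W, wt, e, hm, hK, he, hthr, hgood⟩ :=
      HubWide.universalJoinWide_upto_eighteen h (by omega) h18 (2 ^ h - c) (Nat.sub_le _ _)
    exact ⟨m, K, W, wt, e, hm, hK, he, hthr, fun u hu _ => hgood u hu⟩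
  · by_cases h19 : h = 19
    · subst h19
      exact CoreLift.universalJoinWideLower_coTop_nineteen 19 c (by norm_num) (by omega)
    · exact universalJoinWideLower_coTop_twenty h c (by omega) hc

end TiltCells

end

end Summit.ValiantsHypothesis.ValiantsHypothesis.Theorems.BarrierLever.HiddenStates
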